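import Literature.NumberTheory.EllipticCurves.BertrandCMHeightNonvanishingTwo
import Literature.NumberTheory.EllipticCurves.CanonicalPAdicHeightSqRestrictionProofs
import Literature.NumberTheory.LocalFields.PadicComplexLog
import HarnessLib

/-!
# STUB-IDEAS k2 (gen 23) — `stub_heegnerIndexLowerAtTwo` of crux `SplitBadTwoLowerHalfOfFacts`
# (`stmt-BirchSwinnertonDyer-27851`, route PrintCf2): P-Bert (critic item R154) EXECUTED —
# Bertrand 1984 §3 Cor. 1 in its GENERAL FORM (any number field `L`, any good ordinary `p`,
# `P ∈ E(L)`), typed over `ℂ_p`-EMBEDDINGS, and the ADDITIVE TWIN's 2-adic height datum BY TRANSPORT.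

Scratch sketch of a stub-ideation seat (planner, FAMILY 1 «literature transfer, typed dictionary»).
Nothing here is a tree fact or a proposal; the two `def … : Prop` named-fact CANDIDATES (§2) assert
nothing; every `theorem` is kernel-checked algebra over them; helper statements a prover would still
have to land are the `def H… : Prop` of §4. BSD is NOT proved by any of this.

## Why a new receptacle (the obstruction this file removes)

The tree's number-field receptacle `PAdicHeightDataK.IsCanonicalSq` (`PadicSigmaSq.lean` §3) demands
`p` TOTALLY SPLIT in `K` (`Fintype.card (K →+* ℚ_[p]) = finrank ℚ K`): the places above `p` are read
off the embeddings `K →+* ℚ_p`. The residual class of this crux at `2` with `CMSplit W 2 ∧ ¬ Good W 2`,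
`j = −3375`, consists of the quadratic twists `49a1^{(d)}`, `d ≢ 1 (mod 4)`: ADDITIVE at `2`,
potentially good ordinary, becoming good over `L = ℚ(√d)` in which `2` RAMIFIES — `L` has NO embedding
into `ℚ₂`, so the tree receptacle over `L` is EMPTY and Bertrand's theorem (which has no splitting
condition: "un nombre premier `p` au dessus duquel `E` a bonne réduction ordinaire", LNM 1068 p. 20;
`P ∈ E(ℚ̄)`, Cor. 1 p. 21) cannot even be STATED for the twin in tree currency. The general form of
Balakrishnan–Çiperiani–Stein 2015 eq. (4.1),
`h_{p,F}(P) = p⁻¹(Σ_{℘|p} log_p N_{F_℘/ℚ_p} σ_p(res_℘ P) − Σ_{v∤p} ord_v(d_v) log_p #k_v)`,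
reads, place-free, as a sum over the embeddings `ι : F →+* ℂ_p` (the pairs (`℘`, `τ : F_℘ → ℂ_p`))
of the IWASAWA LOGARITHM `Log : ℂ_p → ℂ_p` (tree: `PadicComplex.iwasawaLog`, Robert V.4.5) of
`Σ_p(−ιx/ιy)`, `Σ_p = σ_p²` the Mazur–Tate sigma-SQUARED series (tree: `padicSigmaSq`; at `p = 2`,
`j = −3375` it is `θ_v²`, tree `cm7_padicSigmaSq_eq_perrinRiouSigma_sq_two`). That is §1.

## Dictionary (Bertrand 1984 §3 ↦ tree)

* `F ⊇ k`, `E/F` CM, `p` good ordinary above ↦ `W : WeierstrassCurve ℚ`, `W.HasCM`,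
  `W.HasGoodReductionAtPrime p ∧ ¬ (p:ℤ) ∣ W.frobeniusTrace p`, `L : Type, [NumberField L]`, points of
  `W.baseChange L` (a CM curve over `ℚ` stays good ordinary above `p` over every `L`).
* `S_𝔭 =` embeddings `σ : F → ℂ_p` inducing a place over `𝔭` ↦ `ι : L →+* ℂ_[p]` (ALL of them: the
  cyclotomic height `h_{1,1}` sums over both `S_𝔭` and `S_𝔭'`; Bertrand's remark p. 21: Cor. 1–2
  "s'étendent aux hauteurs `h_{a,b} = a h_𝔭 + b h_𝔭'` pourvu que `a` et `b` soient `> 0`").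
* `θ_σ ∘ ℓ_σ` (theta of the formal-group logarithm) ↦ `Σ_p(z)`, `z = −ιx/ιy` (`Σ_p = θ²`:
  `log Σ = 2 log θ`, harmless for non-vanishing).
* "à l'addition du logarithme d'un nombre algébrique près" ↦ the term `Log N𝔡(x)`.
* `h_𝔭(P) = 0 ⇒ P` torsion (Cor. 1) ↦ `¬ IsOfFinAddOrder P → DK.pairing P P ≠ 0` (§2).
* Cor. 2 (`h_{a,b}` degenerate on `E(ℚ̄) ⇒ a + b = 0`: the ANTICYCLOTOMIC height `(1,−1)` IS
  degenerate on CM points) ↦ tree barrier `Literature.Barriers.BirchSwinnertonDyer.AnticyclotomicHeightDegeneracy`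
  — the road must use `(a,b) = (1,1)` (cyclotomic, what PRGZ₂ / Disegni measure) or `(1,0)`.

## What the stub gets (consumers, honestly)

Road RT's node (3)₂ (critic R153: `⟨P,P⟩₂ ≠ 0` is needed to DIVIDE by the height in Rubin's
identity) and the leading-term reading of PRGZ₂ on road B⁻ both need, for the ADDITIVE twin `V`,
"the canonical cyclotomic 2-adic height of the generator is non-zero". §3 delivers it from the §2 fact
on the GOOD partner `W` (`j = −3375`, good at `2`) over `L`, by pulling the `L`-datum back along ANY
injective additive map `φ : V(L) →+ W(L)` (instantiated by the tree's `twistPointEquivOver`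
(`Summits/…/Rank1Residual/AdditivePotMult/TwistPointsOver.lean`) or `untwistEquivAt`, composed with
`VariableChange.pointEquiv`s, helper `H_twistTransport`), restricting to `V(ℚ)` and renormalising by
`[L:ℚ]⁻¹`: `twinDatum` — the 2-ADIC analogue of the tree's NÉRON–TATE twist transport
`canonicalHeight_twistPointEquivOver_incl` («the twist transport multiplies canonical heights by the
degree», `Theorems/GoldfeldAllTwistsTwoConverseTwinAdditiveGenusIndexLaw.lean` §3). Over the CM field
`K`: `transportDatumK` (§3, «D1 BY TRANSPORT») — the object k2-g21's D1 line asks for («the canonical-σ²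
datum of W₀ over K(√e) restricted with factor ½»), which is uninhabitable with the tree's totally-split
receptacle and becomes typable with §1. PROVED here: symmetry / torsion-vanishing of the transported datum,
`twinDatum_pairing_self_ne_zero`, `schneider_twin_of_rank_one` (Schneider₂ for the twin in rank one),
the `[L:ℚ]`-normalisation identity, and uniqueness of an `IsCanonicalSqCp` datum given admissible
multiples. NOT delivered: the VALUE side (road D3's (a-∃)), the unit-index digits of (3)₂ (R151's D1
proper), Rubin 1992 (acq-06588, not held).
-/

noncomputable section

set_option linter.dupNamespace false

open scoped Classical
open WeierstrassCurve NumberField IsDedekindDomain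
open Literature.NumberTheory.EllipticCurves Literature.NumberTheory.LocalFields

namespace Summit.BirchSwinnertonDyer.BirchSwinnertonDyer.Cruxes.SplitBadTwoLowerHalfOfFacts.StubIdeasK2G23

/-! ## §1 The place-free receptacle: the canonical `p`-adic height over ANY number field `L` -/

section Receptacle

variable (W : WeierstrassCurve ℚ) (p : ℕ) [Fact p.Prime] (L : Type) [Field L] [NumberField L]

/-- Bernardi's convergence disc `‖t‖ < p^{−1/(p−1)}` in `ℂ_p` (tree `InSigmaDisc` is the `ℚ_p` case).
[cite: SteinWuthrich2013, §4] -/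
def InSigmaDiscCp (t : ℂ_[p]) : Prop :=
  ‖t‖ < (p : ℝ) ^ (-(1 / ((p : ℝ) - 1)))

/-- `Σ_p(t) ∈ ℂ_p` for `t ∈ ℂ_p`: the Mazur–Tate sigma-SQUARED series of `W ⊗ ℚ_p` (coefficients in
`ℤ_p`) summed in `ℂ_p` (`tsum` junk off the disc). [cite: Silverman2005DivPoly, §5 Rem. 2] -/
def padicSigmaSqEvalCp (t : ℂ_[p]) : ℂ_[p] :=
  ∑' n : ℕ, algebraMap ℚ_[p] ℂ_[p] (PowerSeries.coeff n (W.baseChange ℚ_[p]).padicSigmaSq) * t ^ n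

/-- Local conditions on `P = (x, y) ∈ E(L)`, place-free: for EVERY embedding `ι : L →+* ℂ_p`
(= every pair (place `w | p`, `L_w → ℂ_p`)) `‖ιx‖ > 1` (`P ∈ E₁(L_w)`) and `z(ιP)` in the sigma disc;
non-singular reduction at every finite place (tree `HasNonsingularReductionAtK`). For `p` totally split
every `ι` lands in `ℚ_p` and this is the tree's `SatisfiesLocalConditionsK` (`H_consistency`).
[cite: BalakrishnanCiperianiStein2015, §4.1 (conditions (1), (2))] -/
def SatisfiesLocalConditionsCp : (W.baseChange L).toAffine.Point → Prop
  | .zero => False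
  | .some x y _ => (∀ ι : L →+* ℂ_[p], 1 < ‖ι x‖ ∧ InSigmaDiscCp p (-(ι x) / ι y)) ∧
      ∀ v : HeightOneSpectrum (𝓞 L), W.HasNonsingularReductionAtK L v x y

/-- Admissible points of `E(L)`: non-torsion and satisfying the place-free local conditions.
[cite: BalakrishnanCiperianiStein2015, §4.1] -/
def IsAdmissibleCp (P : (W.baseChange L).toAffine.Point) : Prop :=
  ¬ IsOfFinAddOrder P ∧ SatisfiesLocalConditionsCp W p L P

/-- **The canonical cyclotomic `p`-adic height over `L`, sigma-squared form, place-free**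
(Stein–Wuthrich / `−2p`·BCS normalisation, NO splitting hypothesis on `p`):
`ĥ^Σ_{p,L}(P) = Log N𝔡(x) − Σ_{ι : L →+* ℂ_p} Log Σ_p(−ιx/ιy)`, `Log` the Iwasawa logarithm of `ℂ_p`.
For `F_℘/ℚ_p` of degree `n_℘`, `log_p N_{F_℘/ℚ_p} Σ_p(z_℘) = Σ_{τ : F_℘ → ℂ_p} Log Σ_p(τ z_℘)` (the
coefficients of `Σ_p` lie in `ℚ_p`), and `Hom(L, ℂ_p) = ⊔_℘ Hom_cont(L_℘, ℂ_p)`: this is BCS (4.1)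
verbatim, and Bertrand's `−Σ_{v|p} Tr_{F_v/ℚ_p} log_v(θ_v ∘ ℓ_v)` (PM 22 p. 8) up to `2·[F:ℚ]`-type
constants. [cite: BalakrishnanCiperianiStein2015, §4.1 eq. (4.1)] [cite: Bertrand1982, §3 (p. 8)] -/
def canonicalPAdicHeightSqCp : (W.baseChange L).toAffine.Point → ℂ_[p]
  | .zero => 0
  | .some x y _ =>
      PadicComplex.iwasawaLog p ((Ideal.absNorm (denominatorIdeal L x) : ℕ) : ℂ_[p]) -
        ∑ ι : L →+* ℂ_[p], PadicComplex.iwasawaLog p (padicSigmaSqEvalCp W p (-(ι x) / ι y))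

variable {W p L} in
/-- **`DK` is THE canonical cyclotomic `p`-adic height pairing on `E(L)`, sigma-squared form, for an
ARBITRARY number field `L`** (no condition on the splitting of `p`): on every admissible point
`⟨P, P⟩ = ĥ^Σ_{p,L}(P)` in `ℂ_p`. [cite: BalakrishnanCiperianiStein2015, §4.1 eq. (4.1)] -/
def IsCanonicalSqCp (DK : PAdicHeightDataK W p L) : Prop :=
  ∀ P : (W.baseChange L).toAffine.Point, IsAdmissibleCp W p L P →
    algebraMap ℚ_[p] ℂ_[p] (DK.pairing P P) = canonicalPAdicHeightSqCp W p L P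

@[simp] theorem canonicalPAdicHeightSqCp_zero : canonicalPAdicHeightSqCp W p L 0 = 0 := rfl

end Receptacle

/-! ## §2 The named-fact CANDIDATES (assert nothing; a typer files one of them) -/

/-- **Bertrand 1984 §3 Cor. 1, general form, cyclotomic currency** (candidate resolving the tree's
`-- TODO(general form)` of `BertrandCMHeightNonvanishingTwo.lean`): `E/ℚ` with CM, `p` ANY prime of
good ORDINARY reduction, the Mazur–Tate sigma-squared pair of `E ⊗ ℚ_p` existing (kills the junk
branch of `padicSigmaSq`; automatic at odd `p`, a theorem of the tree at `p = 2`, `j = −3375`), `L` ANY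
number field, `DK` THE canonical datum on `E(L)` (place-free receptacle): a point `P ∈ E(L)` of
infinite order has `⟨P,P⟩ ≠ 0`. Source: LNM 1068 p. 20 (setting: "E a bonne réduction ordinaire" above
`p`, no parity, no splitting), p. 21 COROLLAIRE 1 ("Soit `P` un point de `E(ℚ̄)` de hauteur `h_𝔭(P)`
nulle. Alors, `P` est un point de torsion de `E`") and the remark following it (extension to `h_{a,b}`,
`a, b > 0`, so to the cyclotomic `h_{1,1}`); Mazur–Tate 1991 Thm. 3.1 (`σ`/`σ²` computes the canonical
height). [cite: Bertrand1984ThetaCM, §3 Corollaire 1 (p. 21) and Remarque] [cite: Bertrand1982, §3 (p. 8–9)]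
[cite: BalakrishnanCiperianiStein2015, §4.1 eq. (4.1)] -/
def bertrand1984_pairingSq_self_ne_zero_numberField : Prop :=
  ∀ (W : WeierstrassCurve ℚ) [W.IsElliptic] [W.IsGloballyMinimal], W.HasCM →
    ∀ (p : ℕ) [Fact p.Prime], W.HasGoodReductionAtPrime p → ¬ (p : ℤ) ∣ W.frobeniusTrace p →
      (∃ S : PowerSeries ℚ_[p], ∃ c : ℚ_[p], (W.baseChange ℚ_[p]).IsMazurTateSigmaSqPair S c) →
        ∀ (L : Type) [Field L] [NumberField L] (DK : PAdicHeightDataK W p L), IsCanonicalSqCp DK →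
          ∀ P : (W.baseChange L).toAffine.Point, ¬ IsOfFinAddOrder P → DK.pairing P P ≠ 0

/-- **The `p = 2`, `j = −3375` slice over an arbitrary number field** — the exact extension of the
tree's `bertrand_pairingSq_self_ne_zero_two_of_j_eq_neg3375` (`L = ℚ`) that the additive twin needs
(`L = ℚ(√d)`, `2` ramified). Same source lines. [cite: Bertrand1984ThetaCM, §3 Corollaire 1 (p. 21)]
[cite: Bertrand1982, §3 Corollaire 4 (p. 8)] -/
def bertrand_pairingSq_self_ne_zero_two_numberField_of_j_eq_neg3375 : Prop :=
  ∀ (W : WeierstrassCurve ℚ) [W.IsElliptic] [W.IsGloballyMinimal], W.j = -3375 →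
    W.HasGoodReductionAtPrime 2 →
      ∀ (L : Type) [Field L] [NumberField L] (DK : PAdicHeightDataK W 2 L), IsCanonicalSqCp DK →
        ∀ P : (W.baseChange L).toAffine.Point, ¬ IsOfFinAddOrder P → DK.pairing P P ≠ 0

/-- The general candidate implies the slice, given the three arithmetic side inputs on `j = −3375`
curves (CM; `2` ordinary when good — `a₂` odd, cf. tree `cm7_frobeniusTrace_two`; the MT sigma-squared
pair at `2` exists — cf. tree `cm7_existsUnique_isCanonicalSq_two'`). [folklore] -/
theorem slice_of_general (hgen : bertrand1984_pairingSq_self_ne_zero_numberField)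
    (hCM : ∀ (W : WeierstrassCurve ℚ) [W.IsElliptic], W.j = -3375 → W.HasCM)
    (hord : ∀ (W : WeierstrassCurve ℚ) [W.IsElliptic] [W.IsGloballyMinimal], W.j = -3375 →
      W.HasGoodReductionAtPrime 2 → ¬ (2 : ℤ) ∣ W.frobeniusTrace 2)
    (hMT : ∀ (W : WeierstrassCurve ℚ) [W.IsElliptic] [W.IsGloballyMinimal], W.j = -3375 →
      W.HasGoodReductionAtPrime 2 →
        ∃ S : PowerSeries ℚ_[2], ∃ c : ℚ_[2], (W.baseChange ℚ_[2]).IsMazurTateSigmaSqPair S c) :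
    bertrand_pairingSq_self_ne_zero_two_numberField_of_j_eq_neg3375 := by
  intro W _ _ hj hgood L _ _ DK hDK P hP
  exact hgen W (hCM W hj) 2 hgood (hord W hj hgood) (hMT W hj hgood) L DK hDK P hP

/-! ## §3 Transport: the additive twin's datum, and what is PROVED about it -/

section Transport

variable {W V : WeierstrassCurve ℚ} {p : ℕ} [Fact p.Prime] {L : Type} [Field L] [NumberField L]

/-- Pull a datum on `W(L)` back along an additive map `φ : V(L) →+ W(L)`:
`⟨P, Q⟩^φ := ⟨φP, φQ⟩`. [folklore] -/
def pullback (DK : PAdicHeightDataK W p L)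
    (φ : (V.baseChange L).toAffine.Point →+ (W.baseChange L).toAffine.Point) :
    PAdicHeightDataK V p L where
  pairing := (DK.pairing.comp φ).compl₂ φ
  symm P Q := by
    simp only [AddMonoidHom.compl₂_apply, AddMonoidHom.comp_apply]
    exact DK.symm _ _
  map_torsion P Q hP := by
    simp only [AddMonoidHom.compl₂_apply, AddMonoidHom.comp_apply]
    exact DK.map_torsion _ _ (φ.isOfFinAddOrder hP)

@[simp] theorem pullback_pairing (DK : PAdicHeightDataK W p L)
    (φ : (V.baseChange L).toAffine.Point →+ (W.baseChange L).toAffine.Point)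
    (P Q : (V.baseChange L).toAffine.Point) :
    (pullback DK φ).pairing P Q = DK.pairing (φ P) (φ Q) := rfl

/-- Non-isotropy on points of infinite order transports along an INJECTIVE `φ`. [folklore] -/
theorem pullback_pairing_self_ne_zero (DK : PAdicHeightDataK W p L)
    (φ : (V.baseChange L).toAffine.Point →+ (W.baseChange L).toAffine.Point)
    (hφ : Function.Injective φ)
    (hDK : ∀ P : (W.baseChange L).toAffine.Point, ¬ IsOfFinAddOrder P → DK.pairing P P ≠ 0)
    (P : (V.baseChange L).toAffine.Point) (hP : ¬ IsOfFinAddOrder P) :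
    (pullback DK φ).pairing P P ≠ 0 := by
  rw [pullback_pairing]
  exact hDK (φ P) fun h => hP (hφ.isOfFinAddOrder_iff.mp h)

variable (V L) in
/-- `ι_V : V(ℚ) →+ V(L)` (Mathlib's `Affine.Point.map`; equal to the tree's `pointToBaseChange`). -/
def toBaseChange : V.toAffine.Point →+ (V.baseChange L).toAffine.Point :=
  Affine.Point.map (W' := V) (F := ℚ) (Algebra.ofId ℚ L)

theorem toBaseChange_apply (P : V.toAffine.Point) :
    toBaseChange V L P = V.pointToBaseChange L P := by
  rcases P with _ | ⟨x, y, h⟩ <;> rfl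

theorem isOfFinAddOrder_toBaseChange_iff (P : V.toAffine.Point) :
    IsOfFinAddOrder (toBaseChange V L P) ↔ IsOfFinAddOrder P := by
  rw [toBaseChange_apply]
  exact V.isOfFinAddOrder_pointToBaseChange_iff L P

/-- **The twin's `p`-adic height datum on `V(ℚ)` BY TRANSPORT**: `⟨P, Q⟩_V := c · ⟨φ ιP, φ ιQ⟩_{W/L}`
(`c = [L:ℚ]⁻¹` puts it in the tree's `ℚ`-normalisation, cf. `RestrictsTo`). [folklore] -/
def twinDatum (DK : PAdicHeightDataK W p L)
    (φ : (V.baseChange L).toAffine.Point →+ (W.baseChange L).toAffine.Point) (c : ℚ_[p]) :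
    PAdicHeightData V p where
  pairing := (((pullback DK φ).pairing.comp (toBaseChange V L)).compl₂ (toBaseChange V L)).compr₂
    (AddMonoidHom.mulLeft c)
  symm P Q := by
    simp only [AddMonoidHom.compr₂_apply, AddMonoidHom.compl₂_apply, AddMonoidHom.comp_apply,
      AddMonoidHom.coe_mulLeft, pullback_pairing]
    rw [DK.symm]
  map_torsion P Q hP := by
    simp only [AddMonoidHom.compr₂_apply, AddMonoidHom.compl₂_apply, AddMonoidHom.comp_apply,
      AddMonoidHom.coe_mulLeft, pullback_pairing]
    rw [DK.map_torsion _ _ (φ.isOfFinAddOrder ((isOfFinAddOrder_toBaseChange_iff P).mpr hP)),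
      mul_zero]

@[simp] theorem twinDatum_pairing (DK : PAdicHeightDataK W p L)
    (φ : (V.baseChange L).toAffine.Point →+ (W.baseChange L).toAffine.Point) (c : ℚ_[p])
    (P Q : V.toAffine.Point) :
    (twinDatum DK φ c).pairing P Q =
      c * DK.pairing (φ (toBaseChange V L P)) (φ (toBaseChange V L Q)) := rfl

/-- **Normalisation identity** (the `[L:ℚ]` digit of (3)₂'s exponent `e₂`): with `c = [L:ℚ]⁻¹`,
`⟨φιP, φιQ⟩_{W/L} = [L:ℚ]·⟨P, Q⟩_V`. [folklore] -/
theorem pairing_pullback_eq_finrank_mul (DK : PAdicHeightDataK W p L)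
    (φ : (V.baseChange L).toAffine.Point →+ (W.baseChange L).toAffine.Point) (P Q : V.toAffine.Point) :
    DK.pairing (φ (toBaseChange V L P)) (φ (toBaseChange V L Q)) =
      (Module.finrank ℚ L : ℚ_[p]) *
        (twinDatum DK φ ((Module.finrank ℚ L : ℚ_[p])⁻¹)).pairing P Q := by
  have h : (Module.finrank ℚ L : ℚ_[p]) ≠ 0 := by
    exact_mod_cast (Module.finrank_pos (R := ℚ) (M := L)).ne'
  rw [twinDatum_pairing, ← mul_assoc, mul_inv_cancel₀ h, one_mul]

/-- **The transported datum has no isotropic rational point of infinite order** whenever the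
`L`-datum has none on `W(L)` and `φ` is injective (`c ≠ 0`). [folklore] -/
theorem twinDatum_pairing_self_ne_zero (DK : PAdicHeightDataK W p L)
    (φ : (V.baseChange L).toAffine.Point →+ (W.baseChange L).toAffine.Point)
    (hφ : Function.Injective φ) {c : ℚ_[p]} (hc : c ≠ 0)
    (hDK : ∀ P : (W.baseChange L).toAffine.Point, ¬ IsOfFinAddOrder P → DK.pairing P P ≠ 0)
    (P : V.toAffine.Point) (hP : ¬ IsOfFinAddOrder P) :
    (twinDatum DK φ c).pairing P P ≠ 0 := by
  rw [twinDatum_pairing]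
  refine mul_ne_zero hc (hDK _ fun h => hP ?_)
  exact (isOfFinAddOrder_toBaseChange_iff P).mp (hφ.isOfFinAddOrder_iff.mp h)

/-- **Schneider's non-degeneracy for the twin in Mordell–Weil rank one** (the shape the leading-term
reading of PRGZ₂ on road B⁻ consumes): `Reg_p(V, twinDatum) ≠ 0`. Tree rank-one algebra
`PAdicHeightData.not_schneiderConjecture_iff_of_rank_one` + Mordell–Weil. [folklore] -/
theorem schneider_twin_of_rank_one [V.IsElliptic] (hrank : V.mordellWeilRank = 1)
    (DK : PAdicHeightDataK W p L)
    (φ : (V.baseChange L).toAffine.Point →+ (W.baseChange L).toAffine.Point)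
    (hφ : Function.Injective φ) {c : ℚ_[p]} (hc : c ≠ 0)
    (hDK : ∀ P : (W.baseChange L).toAffine.Point, ¬ IsOfFinAddOrder P → DK.pairing P P ≠ 0) :
    SchneiderConjecture (twinDatum DK φ c) := by
  by_contra hS0
  obtain ⟨P, hP, hPP⟩ := ((twinDatum DK φ c).not_schneiderConjecture_iff_of_rank_one hrank
    V.exists_isMordellWeilBasis_holds).mp hS0
  exact twinDatum_pairing_self_ne_zero DK φ hφ hc hDK P hP hPP

/-- **P-Bert for the additive twin (the deliverable of this card)**: from the `p = 2`, `j = −3375`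
slice over `L`, for the GOOD partner `W` (globally minimal, `j = −3375`, good at `2`), THE canonical
`2`-adic datum `DK` on `W(L)`, and any injective additive `φ : V(L) →+ W(L)` (the twist isomorphism
over `L ∋ √d`): every rational point of `V` of infinite order has non-zero transported `2`-adic height.
[cite: Bertrand1984ThetaCM, §3 Corollaire 1 (p. 21)] -/
theorem twin_pairing_self_ne_zero_of_bertrand
    (hB : bertrand_pairingSq_self_ne_zero_two_numberField_of_j_eq_neg3375)
    [W.IsElliptic] [W.IsGloballyMinimal] (hj : W.j = -3375) (hgood : W.HasGoodReductionAtPrime 2)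
    (DK : PAdicHeightDataK W 2 L) (hcan : IsCanonicalSqCp DK)
    (φ : (V.baseChange L).toAffine.Point →+ (W.baseChange L).toAffine.Point)
    (hφ : Function.Injective φ) (P : V.toAffine.Point) (hP : ¬ IsOfFinAddOrder P) :
    (twinDatum DK φ ((Module.finrank ℚ L : ℚ_[2])⁻¹)).pairing P P ≠ 0 := by
  have hc : ((Module.finrank ℚ L : ℚ_[2])⁻¹) ≠ 0 :=
    inv_ne_zero (by exact_mod_cast (Module.finrank_pos (R := ℚ) (M := L)).ne')
  exact twinDatum_pairing_self_ne_zero DK φ hφ hc (hB W hj hgood L DK hcan) P hP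

/-- **Schneider₂ for the additive twin of rank one**, from the slice. [cite: Bertrand1984ThetaCM, §3 Corollaire 1 (p. 21)] -/
theorem schneider_twin_of_bertrand
    (hB : bertrand_pairingSq_self_ne_zero_two_numberField_of_j_eq_neg3375)
    [W.IsElliptic] [W.IsGloballyMinimal] (hj : W.j = -3375) (hgood : W.HasGoodReductionAtPrime 2)
    [V.IsElliptic] (hrank : V.mordellWeilRank = 1)
    (DK : PAdicHeightDataK W 2 L) (hcan : IsCanonicalSqCp DK)
    (φ : (V.baseChange L).toAffine.Point →+ (W.baseChange L).toAffine.Point)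
    (hφ : Function.Injective φ) :
    SchneiderConjecture (twinDatum DK φ ((Module.finrank ℚ L : ℚ_[2])⁻¹)) := by
  have hc : ((Module.finrank ℚ L : ℚ_[2])⁻¹) ≠ 0 :=
    inv_ne_zero (by exact_mod_cast (Module.finrank_pos (R := ℚ) (M := L)).ne')
  exact schneider_twin_of_rank_one hrank DK φ hφ hc (hB W hj hgood L DK hcan)

/-! ### D1 BY TRANSPORT over the CM field `K` (road B⁻'s R151 / D1): `⟨P,Q⟩_{V/K} := c·⟨φ f_*P, φ f_*Q⟩_{W/L}` -/

section OverK

variable {K : Type} [Field K] [NumberField K]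

/-- `f_* : V(K) →+ V(L)` along a field map `f : K →+* L` (Mathlib `Affine.Point.map`). -/
def pushforward (V : WeierstrassCurve ℚ) (f : K →+* L) :
    (V.baseChange K).toAffine.Point →+ (V.baseChange L).toAffine.Point :=
  Affine.Point.map (W' := V) (F := K) f.toRatAlgHom

theorem pushforward_injective (V : WeierstrassCurve ℚ) (f : K →+* L) :
    Function.Injective (pushforward V f) :=
  Affine.Point.map_injective (W' := V) (F := K) f.toRatAlgHom

/-- **The canonical nearly-ordinary `p`-adic height datum of the ADDITIVE twin `V` over `K`, BY
TRANSPORT** (candidate typing of the critic's D1): `⟨P, Q⟩_{V/K} := c·⟨φ f_*P, φ f_*Q⟩_{W/L}` with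
`L = K(√d)`, `f : K → L`, `φ : V(L) → W(L)` the twist isomorphism, `DK` THE canonical datum on `W(L)`
(place-free receptacle), `c = [L:K]⁻¹`. In print this IS the Mazur–Tate / Nekovář cyclotomic height of
`V/K` (functoriality under the `L`-isomorphism `V_L ≅ W_L`; `⟨res P, res Q⟩_L = [L:K]⟨P, Q⟩_K` for the
cyclotomic logarithms `ℓ_L = ℓ_K ∘ N_{L/K}`) — helper `H_nekovarFunctorial`, not asserted here.
[cite: MazurTate1983Biext, §3 (functoriality)] [folklore] -/
def transportDatumK (DK : PAdicHeightDataK W p L) (f : K →+* L)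
    (φ : (V.baseChange L).toAffine.Point →+ (W.baseChange L).toAffine.Point) (c : ℚ_[p]) :
    PAdicHeightDataK V p K where
  pairing := (((pullback DK φ).pairing.comp (pushforward V f)).compl₂ (pushforward V f)).compr₂
    (AddMonoidHom.mulLeft c)
  symm P Q := by
    simp only [AddMonoidHom.compr₂_apply, AddMonoidHom.compl₂_apply, AddMonoidHom.comp_apply,
      AddMonoidHom.coe_mulLeft, pullback_pairing]
    rw [DK.symm]
  map_torsion P Q hP := by
    simp only [AddMonoidHom.compr₂_apply, AddMonoidHom.compl₂_apply, AddMonoidHom.comp_apply,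
      AddMonoidHom.coe_mulLeft, pullback_pairing]
    rw [DK.map_torsion _ _ (φ.isOfFinAddOrder ((pushforward V f).isOfFinAddOrder hP)), mul_zero]

@[simp] theorem transportDatumK_pairing (DK : PAdicHeightDataK W p L) (f : K →+* L)
    (φ : (V.baseChange L).toAffine.Point →+ (W.baseChange L).toAffine.Point) (c : ℚ_[p])
    (P Q : (V.baseChange K).toAffine.Point) :
    (transportDatumK DK f φ c).pairing P Q =
      c * DK.pairing (φ (pushforward V f P)) (φ (pushforward V f Q)) := rfl

/-- **Non-isotropy of `K`-points of infinite order under the transported datum** (what the division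
by `⟨y_K, y_K⟩₂` in (5)₂ / (3)₂ needs for the Heegner point `y_K ∈ V(K)`): from non-isotropy of
`W(L)`-points (Bertrand over `L`), `φ` injective, `c ≠ 0`. [folklore] -/
theorem transportDatumK_pairing_self_ne_zero (DK : PAdicHeightDataK W p L) (f : K →+* L)
    (φ : (V.baseChange L).toAffine.Point →+ (W.baseChange L).toAffine.Point)
    (hφ : Function.Injective φ) {c : ℚ_[p]} (hc : c ≠ 0)
    (hDK : ∀ P : (W.baseChange L).toAffine.Point, ¬ IsOfFinAddOrder P → DK.pairing P P ≠ 0)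
    (P : (V.baseChange K).toAffine.Point) (hP : ¬ IsOfFinAddOrder P) :
    (transportDatumK DK f φ c).pairing P P ≠ 0 := by
  rw [transportDatumK_pairing]
  refine mul_ne_zero hc (hDK _ fun h => hP ?_)
  exact (pushforward_injective V f).isOfFinAddOrder_iff.mp (hφ.isOfFinAddOrder_iff.mp h)

/-- **… from the `p = 2`, `j = −3375` slice**: every `K`-point of `V` of infinite order (e.g. the
Heegner point `y_K` of the frame) has non-zero transported `2`-adic height. [cite: Bertrand1984ThetaCM, §3 Corollaire 1 (p. 21)] -/
theorem transportDatumK_pairing_self_ne_zero_of_bertrand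
    (hB : bertrand_pairingSq_self_ne_zero_two_numberField_of_j_eq_neg3375)
    [W.IsElliptic] [W.IsGloballyMinimal] (hj : W.j = -3375) (hgood : W.HasGoodReductionAtPrime 2)
    (DK : PAdicHeightDataK W 2 L) (hcan : IsCanonicalSqCp DK) (f : K →+* L)
    (φ : (V.baseChange L).toAffine.Point →+ (W.baseChange L).toAffine.Point)
    (hφ : Function.Injective φ) {c : ℚ_[2]} (hc : c ≠ 0)
    (P : (V.baseChange K).toAffine.Point) (hP : ¬ IsOfFinAddOrder P) :
    (transportDatumK DK f φ c).pairing P P ≠ 0 :=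
  transportDatumK_pairing_self_ne_zero DK f φ hφ hc (hB W hj hgood L DK hcan) P hP

end OverK

/-! ### CM adjointness ⟹ full non-degeneracy over `K` in `𝒪_K`-rank one (Bertrand's Cor. 3 shape) -/

/-- **Gram determinant under an anti-adjoint operator**: for a symmetric pairing `B` and an additive
`s` with `B(sP, Q) = −B(P, sQ)` (the Rosati adjoint of `√−D` is `−√−D`) and `s² = −D`, the Gram
determinant of `(P, sP)` is `D·B(P,P)²`. So on the CM plane `𝒪_K·P ⊂ V(K)` Bertrand's DIAGONAL
non-vanishing gives NON-DEGENERACY (Schneider over `K`), and `B(P, sP) = 0` is Bertrand's Cor. 3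
("`⟨P₁, P₂⟩ = 0 ⟹ P₂` is the image of `P₁` by an element of `K` of trace zero").
[cite: Bertrand1984ThetaCM, §3 Corollaire 3 (p. 22)] [folklore] -/
theorem gram_det_of_antiAdjoint {A : Type*} [AddCommGroup A] (B : A →+ A →+ ℚ_[p])
    (hsymm : ∀ P Q, B P Q = B Q P) (s : A →+ A) (D : ℤ)
    (hadj : ∀ P Q, B (s P) Q = -B P (s Q)) (hss : ∀ P, s (s P) = -(D • P)) (P : A) :
    B P P * B (s P) (s P) - B P (s P) * B (s P) P = D * (B P P) ^ 2 := by
  have h0 : B P (s P) = 0 := by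
    have h1 : B P (s P) = -B P (s P) := by
      conv_lhs => rw [hsymm, hadj]
    have h2 : (2 : ℚ_[p]) * B P (s P) = 0 := by linear_combination h1
    exact (mul_eq_zero.mp h2).resolve_left two_ne_zero
  have h2 : B (s P) (s P) = D * B P P := by
    rw [hadj, hss, map_neg, map_zsmul, neg_neg, zsmul_eq_mul]
  rw [h0, zero_mul, sub_zero, h2]
  ring

/-- Corollary: `D ≠ 0 ∧ B(P,P) ≠ 0 ⟹` the Gram determinant of `(P, sP)` is non-zero. [folklore] -/
theorem gram_det_ne_zero_of_antiAdjoint {A : Type*} [AddCommGroup A] (B : A →+ A →+ ℚ_[p])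
    (hsymm : ∀ P Q, B P Q = B Q P) (s : A →+ A) {D : ℤ} (hD : D ≠ 0)
    (hadj : ∀ P Q, B (s P) Q = -B P (s Q)) (hss : ∀ P, s (s P) = -(D • P)) {P : A}
    (hP : B P P ≠ 0) :
    B P P * B (s P) (s P) - B P (s P) * B (s P) P ≠ 0 := by
  rw [gram_det_of_antiAdjoint B hsymm s D hadj hss P]
  exact mul_ne_zero (by exact_mod_cast hD) (pow_ne_zero 2 hP)

/-! ### Uniqueness of the canonical `L`-datum, given admissible multiples (Mazur–Tate "extends uniquely") -/

/-- **Two `IsCanonicalSqCp` data coincide** as soon as every point of infinite order has an admissible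
multiple (`H_admissibleMultiples`): tree `pairing_eq_of_sq_eq_on` + injectivity of `ℚ_p → ℂ_p`.
[cite: MazurSteinTate2006, §1 ("extends uniquely")] -/
theorem isCanonicalSqCp_unique {DK₁ DK₂ : PAdicHeightDataK W p L}
    (hmult : ∀ P : (W.baseChange L).toAffine.Point, ¬ IsOfFinAddOrder P →
      ∃ m : ℕ, m ≠ 0 ∧ IsAdmissibleCp W p L (m • P))
    (h₁ : IsCanonicalSqCp DK₁) (h₂ : IsCanonicalSqCp DK₂) : DK₁.pairing = DK₂.pairing := by
  refine pairing_eq_of_sq_eq_on DK₁.pairing DK₂.pairing DK₁.symm DK₂.symm DK₁.map_torsion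
    DK₂.map_torsion {P | IsAdmissibleCp W p L P} hmult fun Q hQ => ?_
  exact (algebraMap ℚ_[p] ℂ_[p]).injective ((h₁ Q hQ).trans (h₂ Q hQ).symm)

end Transport

/-! ## §4 Helper statements a prover would land (Props only; presearched, see the card) -/

section Helpers

/-- **H_consistency** — for `p` TOTALLY SPLIT in `L` the place-free receptacle IS the tree's:
every `ι : L →+* ℂ_p` factors through `ℚ_p`, `Log|_{ℚ_p^×} = log_p` (tree `iwasawaLog_coe_padicInt`,
`iwasawaLog_mem_of_isClosed_subfield`), `InSigmaDiscCp ∘ ℚ_p = InSigmaDisc`. [folklore] -/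
def H_consistency : Prop :=
  ∀ (W : WeierstrassCurve ℚ) (p : ℕ) [Fact p.Prime] (L : Type) [Field L] [NumberField L]
    (DK : PAdicHeightDataK W p L), Fintype.card (L →+* ℚ_[p]) = Module.finrank ℚ L →
      (IsCanonicalSqCp DK ↔ DK.IsCanonicalSq)

/-- **H_admissibleMultiples** — every `P ∈ E(L)` of infinite order has a multiple satisfying the
place-free local conditions (finite index of `E_r(L_w) ⊂ E(L_w)` for the `r` with `E_r ⊂` sigma disc —
over a RAMIFIED `L_w/ℚ₂` of index `e = 2` one needs `n ≥ 3` half-steps; and `c_v·#Ẽ_ns(k_v)` kills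
the bad places), the `L`-analogue of the tree's `exists_admissible_nsmul_holds`. [cite: MazurSteinTate2006, §1] -/
def H_admissibleMultiples : Prop :=
  ∀ (W : WeierstrassCurve ℚ) [W.IsElliptic] [W.IsGloballyMinimal] (p : ℕ) [Fact p.Prime]
    (L : Type) [Field L] [NumberField L], W.HasGoodReductionAtPrime p →
      ∀ P : (W.baseChange L).toAffine.Point, ¬ IsOfFinAddOrder P →
        ∃ m : ℕ, m ≠ 0 ∧ IsAdmissibleCp W p L (m • P)

/-- **H_existence** — THE canonical datum exists on `E(L)` for `E/ℚ` CM-or-not, `p` good ordinary with a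
Mazur–Tate sigma-squared pair (Mazur–Tate 1983 biextension height; its sigma formula MT 1991 Thm 3.1 /
BCS 2015 (4.1); values in `ℚ_p` by Galois-equivariance of `Log`, tree `iwasawaLog_apply_ringEquiv`).
The `L`-analogue of the tree's `exists_isCanonicalSqK_two` / `cm7_existsUnique_isCanonicalSq_two'`.
[cite: MazurSteinTate2006, Thm. 1.3] [cite: BalakrishnanCiperianiStein2015, §4.1 eq. (4.1)] -/
def H_existence : Prop :=
  ∀ (W : WeierstrassCurve ℚ) [W.IsElliptic] [W.IsGloballyMinimal] (p : ℕ) [Fact p.Prime],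
    W.HasGoodReductionAtPrime p → ¬ (p : ℤ) ∣ W.frobeniusTrace p →
      (∃ S : PowerSeries ℚ_[p], ∃ c : ℚ_[p], (W.baseChange ℚ_[p]).IsMazurTateSigmaSqPair S c) →
        ∀ (L : Type) [Field L] [NumberField L], ∃ DK : PAdicHeightDataK W p L, IsCanonicalSqCp DK

/-- **H_twistTransport** — the twist isomorphism over `L ∋ θ`, `θ² = d`, as an additive equivalence of
`L`-points between ANY two `ℚ`-models: `V` a model of `E^{(d)}` and `W` a model of `E` (through a
short model `W₀`: tree `twistPointEquivOver W₀ ht htc : ((W₀.quadraticTwist d).baseChange L).Point ≃+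
(W₀.baseChange L).Point` (`TwistPointsOver.lean`, `√d ∉ ℚ`) or `untwistEquivAt W₀`, composed with
`VariableChange.pointEquiv` / `Affine.Point.congrEquiv` as in the Néron–Tate precedent
`canonicalHeight_twistPointEquivOver_incl_congr_pointEquiv`). [cite: SilvermanAEC2009, X.5 Cor. 5.4 (iii)] -/
def H_twistTransport : Prop :=
  ∀ (W V W₀ : WeierstrassCurve ℚ) [W.IsElliptic] [W₀.IsCharNeTwoNF] (d : ℚ), d ≠ 0 →
    (∃ u : VariableChange ℚ, u • W = W₀) → (∃ u' : VariableChange ℚ, u' • V = W₀.quadraticTwist d) →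
      ∀ (L : Type) [Field L] [NumberField L] (θ : L), θ ^ 2 = algebraMap ℚ L d →
        Nonempty ((V.baseChange L).toAffine.Point ≃+ (W.baseChange L).toAffine.Point)

/-- **H_nekovarFunctorial** — the transported datum IS the canonical (Mazur–Tate 1983 / Nekovář)
cyclotomic height of `V/K`: (i) functoriality under the `L`-isomorphism `V_L ≅ W_L`, (ii)
`⟨res P, res Q⟩_{L} = [L:K]·⟨P, Q⟩_{K}` (cyclotomic logarithm `ℓ_L = ℓ_K ∘ N_{L/K}`). Typed here only
in the form "restriction from `ℚ` to `K` scales by `[K:ℚ]`" that the tree already uses (`RestrictsTo`);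
the `K`-to-`L` / isomorphism clauses are the reviewer's citations for R151's canonicity predicate.
[cite: MazurSteinTate2006, §2.8] [cite: BalakrishnanCiperianiStein2015, §4.1] -/
def H_nekovarFunctorial : Prop :=
  ∀ (W : WeierstrassCurve ℚ) [W.IsElliptic] [W.IsGloballyMinimal] (p : ℕ) [Fact p.Prime]
    (L : Type) [Field L] [NumberField L] (DK : PAdicHeightDataK W p L) (D : PAdicHeightData W p),
      IsCanonicalSqCp DK → D.IsCanonicalSq → DK.RestrictsTo D

/-- **H_cmAdjoint** — the CM endomorphism `[√−D]` acts on `V(K)` by an additive `s` with `s² = −D`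
and is ANTI-adjoint for the canonical height (`⟨[α]P, Q⟩ = ⟨P, [ᾱ]Q⟩`: the height is equivariant for
`End⁰`, Burungale–Disegni 2020 §1 p. 3; Mazur–Tate 1983 functoriality), stated over an abstract
additive endomorphism to stay inside typed vocabulary. [cite: MazurTate1983Biext, §3] -/
def H_cmAdjoint : Prop :=
  ∀ (V : WeierstrassCurve ℚ) [V.IsElliptic] (p : ℕ) [Fact p.Prime] (K : Type) [Field K] [NumberField K]
    (D : ℤ) (s : (V.baseChange K).toAffine.Point →+ (V.baseChange K).toAffine.Point),
      (∀ P, s (s P) = -(D • P)) → ∀ (DV : PAdicHeightDataK V p K),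
        (∃ (W : WeierstrassCurve ℚ) (L : Type) (_ : Field L) (_ : NumberField L)
            (DK : PAdicHeightDataK W p L) (f : K →+* L)
            (φ : (V.baseChange L).toAffine.Point →+ (W.baseChange L).toAffine.Point) (c : ℚ_[p]),
            IsCanonicalSqCp DK ∧ DV = transportDatumK DK f φ c) →
          ∀ P Q, DV.pairing (s P) Q = -DV.pairing P (s Q)

end Helpers

end Summit.BirchSwinnertonDyer.BirchSwinnertonDyer.Cruxes.SplitBadTwoLowerHalfOfFacts.StubIdeasK2G23

end
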